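import Mathlib
import Summits.Ventures.PercRepro2.Defs
import Summits.Ventures.PercRepro2.Independence
import Summits.Ventures.PercRepro2.Harris
import Summits.Ventures.PercRepro2.Graph
import Summits.Ventures.PercRepro2.Exploration
import Summits.Ventures.PercRepro2.Events
import Summits.Ventures.PercRepro2.FourFunctions
import Summits.Ventures.PercRepro2.Induced
import Summits.Ventures.PercRepro2.Frontier
import Summits.Ventures.PercRepro2.ObsIndependence
import Summits.Ventures.PercRepro2.BHK
import Summits.Ventures.PercRepro2.BHKEvents
import Summits.Ventures.PercRepro2.MultiSource
import Summits.Ventures.PercRepro2.OrderPreservation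
import Summits.Ventures.PercRepro2.SeedSet
import Summits.Ventures.PercRepro2.MultiSourceFun
import Summits.Ventures.PercRepro2.CrossRootT
import Summits.Ventures.PercRepro2.VdBKahn
import Summits.Ventures.PercRepro2.HullDefs
import Summits.Ventures.PercRepro2.CCTRootEdge
import Summits.Ventures.PercRepro2.R1Rung
import Summits.Ventures.PercRepro2.CC2Rung
import Summits.Ventures.PercRepro2.PASubDefs
import Summits.Ventures.PercRepro2.HalfN

/-!
# Row 2′CCT-LIN: the T-frame linearisation (L1-K) and the target (CC-T⁻), with the rigorous
reduction (L1-K) ⟹ (CC-T) (blind cell PercRepro2, typer-1; mine-c g3 MINE-C.md §10.3–10.4; lead g11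
CONJECTURES v2.99l 11:17:35Z — (L1-S)/(L1-K) census-promoted at n ≤ 6 in two implementations)

Objects (an edge `e`, root `s`, avoided set `T`, targets `a, b`, all events of `ω`):
`K⁺ = C_{ω⁺}(T)` (`PASub.Kset`), `λ₁(W) = P(K⁺ = W)` (`PASub.KEvent`), `x₁(W) = P(XdelP W a)` (the
`e`-open `W`-deleted connection, `HalfN.XdelP`), `X⁺ = {s ↔ a in ω⁺}` (`Xplus`), `R⁺` (`PASub.Rplus`),
and the `e`-closed masses `P₀ = P(R_T)`, `F₀ᵃ = P(R_T ∩ {s ↔ a})` under `p[e ↦ 0]` (`TwoSetRung.massP/F`).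

* **`L1K`** (cleared by `P₀²`): `0 ≤ P₀² Σ x₁ y₁ λ₁ − P₀ (F₀ᵃ Σ y₁ λ₁ + F₀ᵇ Σ x₁ λ₁) + F₀ᵃ F₀ᵇ Σ λ₁`,
  i.e. `E_{λ₁}[(x₁(K) − m⁰_X)(y₁(K) − m⁰_Y)] ≥ 0`;
* **`CCTMinus`** (cleared): `E_{μ₀}[(X⁻ − m⁰_X)(Y⁻ − m⁰_Y); R⁺] ≥ 0` — the prover target `T1 ≥ 0`;
* **`CC2_of_L1K`**: `(L1-K) ⟹ (CC-T)` (`TwoSetRung.CC2 p ends e s {a} {b} T T`): on `{K⁺ = W}` the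
  `e`-open connections are their `W`-deleted versions (`mem_Xplus_iff_of_K`), independent of `{K⁺ = W}`
  (`dependsOn_XdelP`), and `P(X_W ∩ Y_W) ≥ x₁(W) y₁(W)` by Harris — so the joint `e`-open mass
  dominates the linearised one, termwise.
-/

namespace Summit.Ventures.PercRepro2

namespace CCTLin

open PASub HalfN TwoSetRung

open scoped Classical

variable {V : Type*} {E : Type*} [Fintype E] [DecidableEq E] [Fintype V] [DecidableEq V]
  {R : Type*} [Field R] [LinearOrder R] [IsStrictOrderedRing R]

section Objects

variable (ends : E → Sym2 V) (e : E) (s : V) (T : Finset V)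

/-- The `e`-open connection event `{s ↔ a in ω⁺}`. -/
def Xplus (a : V) : Set (Config E) := {ω | Conn ends (Function.update ω e true) s a}

omit [Fintype E] [DecidableEq V] [Fintype V] in
/-- On `{K⁺ = W}` (with `s ∉ W`), the `e`-open connection equals its `W`-deleted version. -/
lemma mem_Xplus_iff_of_K {ω : Config E} {W : Set V} (hK : Kset ends e T ω = W) (hs : s ∉ W) (a : V) :
    ω ∈ Xplus ends e s a ↔ ω ∈ XdelP ends e s W a := by
  simp only [Xplus, XdelP, Set.mem_setOf_eq]
  constructor
  · intro hc
    have hsub : cluster ends (Function.update ω e true) s ⊆ Wᶜ := by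
      intro x hx hxW
      apply hs
      rw [← hK]
      obtain ⟨t, ht, htx⟩ := hK ▸ hxW
      exact ⟨t, ht, conn_trans htx (conn_symm hx)⟩
    exact conn_delConfig_of_cluster_subset_compl ends hsub hc
  · intro hc
    exact conn_mono (fun e' => by
      by_cases h : e' ∈ touches ends W
      · rw [delConfig_apply_of_mem h]; exact Bool.false_le _
      · rw [delConfig_apply_of_notMem h]) hc

omit [Fintype E] [DecidableEq V] [Fintype V] in
/-- `XdelP W a` depends only on the edges not touching `W`. -/
lemma dependsOn_XdelP (W : Set V) (a : V) :
    DependsOn (· ∈ XdelP ends e s W a) (touches ends W)ᶜ := by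
  intro ω ω' h
  have h' : delConfig ends W (Function.update ω e true) =
      delConfig ends W (Function.update ω' e true) := by
    refine delConfig_congr fun e' he' => ?_
    by_cases hee : e' = e
    · subst hee; simp
    · rw [Function.update_of_ne hee, Function.update_of_ne hee]; exact h e' he'
  show (Conn ends (delConfig ends W (Function.update ω e true)) s a) =
    (Conn ends (delConfig ends W (Function.update ω' e true)) s a)
  rw [h']

omit [Fintype E] [DecidableEq V] [Fintype V] in
/-- `XdelP W a` is increasing. -/
lemma isUpperSet_XdelP (W : Set V) (a : V) : IsUpperSet (XdelP ends e s W a) := by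
  intro ω ω' hle hω
  have hle' : delConfig ends W (Function.update ω e true) ≤
      delConfig ends W (Function.update ω' e true) := by
    intro e'
    by_cases h : e' ∈ touches ends W
    · rw [delConfig_apply_of_mem h]; exact Bool.false_le _
    · rw [delConfig_apply_of_notMem h, delConfig_apply_of_notMem h]
      by_cases hee : e' = e
      · subst hee; simp
      · rw [Function.update_of_ne hee, Function.update_of_ne hee]; exact hle e'
  exact conn_mono hle' hω

end Objects

section Rows

variable (p : E → R) (ends : E → Sym2 V) (e : E) (s : V) (T : Finset V)

/-- **(L1-K)** (mine-c §10.4), cleared by `P₀²`: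
`0 ≤ P₀² Σ x₁y₁λ₁ − P₀ (F₀ᵃ Σ y₁λ₁ + F₀ᵇ Σ x₁λ₁) + F₀ᵃ F₀ᵇ Σ λ₁`. -/
def L1K (a b : V) : Prop :=
  0 ≤ massP (Function.update p e 0) ends s T ^ 2 *
        (∑ W : Set V, if s ∉ W then
          prob p (XdelP ends e s W a) * prob p (XdelP ends e s W b) * prob p (KEvent ends e T W)
          else 0) -
      massP (Function.update p e 0) ends s T *
        (massF (Function.update p e 0) ends s {a} T *
            (∑ W : Set V, if s ∉ W then prob p (XdelP ends e s W b) * prob p (KEvent ends e T W)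
              else 0) +
          massF (Function.update p e 0) ends s {b} T *
            (∑ W : Set V, if s ∉ W then prob p (XdelP ends e s W a) * prob p (KEvent ends e T W)
              else 0)) +
      massF (Function.update p e 0) ends s {a} T * massF (Function.update p e 0) ends s {b} T *
        (∑ W : Set V, if s ∉ W then prob p (KEvent ends e T W) else 0)

/-- **(CC-T⁻)** `[T1 ≥ 0]` (mine-c §10.3), cleared by `P₀²`:
`E_{μ₀}[(X⁻ − m⁰_X)(Y⁻ − m⁰_Y); R⁺] ≥ 0` for the `e`-closed connections under the `e`-open avoidance. -/
def CCTMinus (a b : V) : Prop :=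
  0 ≤ massP (Function.update p e 0) ends s T ^ 2 *
        prob p (Xminus ends e s a ∩ Xminus ends e s b ∩ Rplus ends e s T) -
      massP (Function.update p e 0) ends s T *
        (massF (Function.update p e 0) ends s {a} T * prob p (Xminus ends e s b ∩ Rplus ends e s T) +
          massF (Function.update p e 0) ends s {b} T *
            prob p (Xminus ends e s a ∩ Rplus ends e s T)) +
      massF (Function.update p e 0) ends s {a} T * massF (Function.update p e 0) ends s {b} T *
        prob p (Rplus ends e s T)

end Rows

section Closure

variable (R : Type*) [Field R] [LinearOrder R] [IsStrictOrderedRing R]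

/-- (L1-K) over all finite graphs, admissible weights, edges, roots, avoided sets and targets. -/
def L1K_all : Prop :=
  ∀ (V E : Type) [Fintype V] [DecidableEq V] [Fintype E] [DecidableEq E]
    (ends : E → Sym2 V) (p : E → R), IsProbVec p →
    ∀ (e : E) (s : V) (T : Finset V) (a b : V), s ∉ T → a ∉ T → b ∉ T → L1K p ends e s T a b

/-- (CC-T⁻) over all finite graphs, admissible weights, edges, roots, avoided sets and targets. -/
def CCTMinus_all : Prop :=
  ∀ (V E : Type) [Fintype V] [DecidableEq V] [Fintype E] [DecidableEq E]
    (ends : E → Sym2 V) (p : E → R), IsProbVec p →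
    ∀ (e : E) (s : V) (T : Finset V) (a b : V), s ∉ T → a ∉ T → b ∉ T → CCTMinus p ends e s T a b

end Closure

/-! ## (L1-K) ⟹ (CC-T) -/

section Reduction

variable (p : E → R) (ends : E → Sym2 V) (e : E) (s : V) (T : Finset V)

omit [Fintype V] [DecidableEq V] [LinearOrder R] [IsStrictOrderedRing R] in
/-- The `e`-open masses as events of `ω`: `F₁ᵃ = P(X⁺ ∩ R⁺)`. -/
lemma massF_update_one_eq (a : V) :
    massF (Function.update p e 1) ends s {a} T = prob p (Xplus ends e s a ∩ Rplus ends e s T) := by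
  unfold massF
  rw [CCT.prob_update_one_eq]
  congr 1
  ext ω
  simp only [Set.mem_setOf_eq, Set.mem_inter_iff, connAll, Finset.mem_singleton, forall_eq, Xplus,
    Rplus]
  tauto

omit [Fintype V] [LinearOrder R] [IsStrictOrderedRing R] in
/-- `F₁ᵃᵇ = P(X⁺ ∩ Y⁺ ∩ R⁺)`. -/
lemma massF_update_one_pair_eq (a b : V) :
    massF (Function.update p e 1) ends s ({a} ∪ {b}) T =
      prob p (Xplus ends e s a ∩ Xplus ends e s b ∩ Rplus ends e s T) := by
  unfold massF
  rw [CCT.prob_update_one_eq]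
  congr 1
  ext ω
  simp only [Set.mem_setOf_eq, Set.mem_inter_iff, connAll, Finset.mem_union, Finset.mem_singleton,
    Xplus, Rplus]
  constructor
  · rintro ⟨hR, h⟩
    exact ⟨⟨h a (Or.inl rfl), h b (Or.inr rfl)⟩, hR⟩
  · rintro ⟨⟨ha, hb⟩, hR⟩
    refine ⟨hR, fun x hx => ?_⟩
    rcases hx with rfl | rfl
    · exact ha
    · exact hb

omit [Fintype V] [DecidableEq V] [LinearOrder R] [IsStrictOrderedRing R] in
/-- `P₁ = P(R⁺)`. -/
lemma massP_update_one_eq :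
    massP (Function.update p e 1) ends s T = prob p (Rplus ends e s T) := by
  unfold massP
  rw [CCT.prob_update_one_eq]
  rfl

omit [Fintype V] [DecidableEq V] [LinearOrder R] [IsStrictOrderedRing R] in
/-- Independence of `X_W ∩ Y_W` (e-open) from `{K⁺ = W}`. -/
lemma prob_XdelP_inter_XdelP_inter_KEvent (W : Set V) (a b : V) :
    prob p (XdelP ends e s W a ∩ XdelP ends e s W b ∩ KEvent ends e T W) =
      prob p (XdelP ends e s W a ∩ XdelP ends e s W b) * prob p (KEvent ends e T W) := by
  have hd := dependsOn_inter (dependsOn_XdelP ends e s W a) (dependsOn_XdelP ends e s W b)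
  rw [Set.union_self] at hd
  exact prob_inter_eq_mul_of_dependsOn p (F₁ := (touches ends W)ᶜ) (F₂ := touches ends W)
    disjoint_compl_left hd (dependsOn_KEvent ends e T W)

omit [Fintype V] [DecidableEq V] [LinearOrder R] [IsStrictOrderedRing R] in
/-- Independence of `X_W` (e-open) from `{K⁺ = W}`. -/
lemma prob_XdelP_inter_KEvent (W : Set V) (a : V) :
    prob p (XdelP ends e s W a ∩ KEvent ends e T W) =
      prob p (XdelP ends e s W a) * prob p (KEvent ends e T W) :=
  prob_inter_eq_mul_of_dependsOn p (F₁ := (touches ends W)ᶜ) (F₂ := touches ends W)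
    disjoint_compl_left (dependsOn_XdelP ends e s W a) (dependsOn_KEvent ends e T W)

/-- **(L1-K) ⟹ (CC-T)** (mine-c §10.4, rigorous): the T-frame linearisation implies the first rung
`TwoSetRung.CC2 p ends e s {a} {b} T T`. -/
theorem CC2_of_L1K (hp : IsProbVec p) (a b : V) (h : L1K p ends e s T a b) :
    CC2 p ends e s {a} {b} T T := by
  unfold CC2
  rw [Finset.inter_self, Finset.union_self, massF_update_one_eq, massF_update_one_eq,
    massF_update_one_pair_eq, massP_update_one_eq]
  unfold L1K at h
  -- the three `e`-open masses through the partition by `K⁺`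
  have hX : prob p (Xplus ends e s a ∩ Rplus ends e s T) =
      ∑ W : Set V, if s ∉ W then prob p (XdelP ends e s W a) * prob p (KEvent ends e T W) else 0 := by
    rw [prob_inter_Rplus_eq_sum]
    refine Finset.sum_congr rfl fun W _ => ?_
    by_cases hs : s ∉ W
    · rw [if_pos hs, if_pos hs, ← prob_XdelP_inter_KEvent]
      congr 1
      ext ω
      simp only [Set.mem_inter_iff]
      constructor
      · rintro ⟨hx, hK⟩; exact ⟨(mem_Xplus_iff_of_K ends e s T hK hs a).1 hx, hK⟩
      · rintro ⟨hx, hK⟩; exact ⟨(mem_Xplus_iff_of_K ends e s T hK hs a).2 hx, hK⟩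
    · rw [if_neg hs, if_neg hs]
  have hY : prob p (Xplus ends e s b ∩ Rplus ends e s T) =
      ∑ W : Set V, if s ∉ W then prob p (XdelP ends e s W b) * prob p (KEvent ends e T W) else 0 := by
    rw [prob_inter_Rplus_eq_sum]
    refine Finset.sum_congr rfl fun W _ => ?_
    by_cases hs : s ∉ W
    · rw [if_pos hs, if_pos hs, ← prob_XdelP_inter_KEvent]
      congr 1
      ext ω
      simp only [Set.mem_inter_iff]
      constructor
      · rintro ⟨hx, hK⟩; exact ⟨(mem_Xplus_iff_of_K ends e s T hK hs b).1 hx, hK⟩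
      · rintro ⟨hx, hK⟩; exact ⟨(mem_Xplus_iff_of_K ends e s T hK hs b).2 hx, hK⟩
    · rw [if_neg hs, if_neg hs]
  have hXY : prob p (Xplus ends e s a ∩ Xplus ends e s b ∩ Rplus ends e s T) =
      ∑ W : Set V, if s ∉ W then
        prob p (XdelP ends e s W a ∩ XdelP ends e s W b) * prob p (KEvent ends e T W) else 0 := by
    rw [prob_inter_Rplus_eq_sum]
    refine Finset.sum_congr rfl fun W _ => ?_
    by_cases hs : s ∉ W
    · rw [if_pos hs, if_pos hs, ← prob_XdelP_inter_XdelP_inter_KEvent]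
      congr 1
      ext ω
      simp only [Set.mem_inter_iff]
      constructor
      · rintro ⟨⟨hx, hy⟩, hK⟩
        exact ⟨⟨(mem_Xplus_iff_of_K ends e s T hK hs a).1 hx,
          (mem_Xplus_iff_of_K ends e s T hK hs b).1 hy⟩, hK⟩
      · rintro ⟨⟨hx, hy⟩, hK⟩
        exact ⟨⟨(mem_Xplus_iff_of_K ends e s T hK hs a).2 hx,
          (mem_Xplus_iff_of_K ends e s T hK hs b).2 hy⟩, hK⟩
    · rw [if_neg hs, if_neg hs]
  have hR : prob p (Rplus ends e s T) =
      ∑ W : Set V, if s ∉ W then prob p (KEvent ends e T W) else 0 := by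
    have := prob_inter_Rplus_eq_sum p ends e s T Set.univ
    rw [Set.univ_inter] at this
    rw [this]
    refine Finset.sum_congr rfl fun W _ => ?_
    rw [Set.univ_inter]
  -- Harris termwise: the joint mass dominates the linearised one
  have hHarris : (∑ W : Set V, if s ∉ W then
      prob p (XdelP ends e s W a) * prob p (XdelP ends e s W b) * prob p (KEvent ends e T W)
      else 0) ≤
      ∑ W : Set V, if s ∉ W then
        prob p (XdelP ends e s W a ∩ XdelP ends e s W b) * prob p (KEvent ends e T W) else 0 := by
    refine Finset.sum_le_sum fun W _ => ?_
    by_cases hs : s ∉ W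
    · rw [if_pos hs, if_pos hs]
      exact mul_le_mul_of_nonneg_right
        (prob_mul_prob_le_prob_inter hp (isUpperSet_XdelP ends e s W a)
          (isUpperSet_XdelP ends e s W b)) (prob_nonneg hp _)
    · rw [if_neg hs, if_neg hs]
  rw [hX, hY, hXY, hR]
  have hP2 : 0 ≤ massP (Function.update p e 0) ends s T ^ 2 := sq_nonneg _
  nlinarith [h, mul_le_mul_of_nonneg_left hHarris hP2]

end Reduction

end CCTLin

end Summit.Ventures.PercRepro2
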